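import Summits.CriticalPhenomena.SAWScalingLimit.Theorems.SAWLoopFugacityFlowIsingBoundaryRatioWindowRectProbes
import HarnessLib

/-!
# Window rectangle: heights, hands and level crossings along the boundary cycle
(line `fk-anchor-transfer`, crux `IsingBoundaryRatio`, stmt-CriticalPhenomena-10650; helper file of the stub
`windowRectPresentation_holds : WindowRectPresentation`)

In the static setting `X : WSetting`, the **height** of a position `i` of the boundary cycle is the chart radius
`X.hgt i` of its site; it moves by at most `κ` per step (`abs_hgt_sub_le`). Positions of **mid** height
(`[w₁ + κ, w₂ - κ]`) are rough, hence left or right, and consecutive rough positions have the same hand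
(`lft_succ_iff`), so the hand is constant along intervals of rough positions (`lft_iff_of_interval`); the
boundary parameter of a left (right) position is within `κ` of minus (plus) its height. Finally two
elementary **level-crossing** lemmas for real sequences (`exists_last_ge`, `exists_first_ge` and their mirror
images): the last index of an interval at which a sequence is `≥ ℓ`, the first at which it is `≥ ℓ`. [folklore]
-/

noncomputable section

open scoped Classical Topology Real
open Filter Set Metric Complex
open Literature.Probability.LatticeModels Literature.Probability.RandomPlanarGeometry
open Literature.Probability.LatticeModels.DiscreteRect Literature.Topology.PlaneTopology
open UpperHalfPlane (upperHalfPlaneSet)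

namespace Summit.CriticalPhenomena.SAWScalingLimit.Theorems.IsingBoundaryRatio

namespace WindowRect

/-! ### Level crossings of real sequences -/

/-- **Last index `≥ ℓ`**: if `h s ≥ ℓ > h t` (`s ≤ t`), there is a last `j ∈ [s, t)` with `h j ≥ ℓ`; after it
the sequence stays `< ℓ` up to `t`. [folklore] -/
theorem exists_last_ge {h : ℕ → ℝ} {ℓ : ℝ} {s t : ℕ} (hst : s ≤ t) (hs : ℓ ≤ h s) (ht : h t < ℓ) :
    ∃ j, s ≤ j ∧ j < t ∧ ℓ ≤ h j ∧ ∀ i, j < i → i ≤ t → h i < ℓ := by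
  set P : ℕ → Prop := fun i => s ≤ i ∧ ℓ ≤ h i with hP
  have hex : ∃ i, i ≤ t ∧ P i := ⟨s, hst, le_rfl, hs⟩
  set j := Nat.findGreatest P t with hj
  obtain ⟨i₀, hi₀t, hPi₀⟩ := hex
  have hPj : P j := Nat.findGreatest_spec hi₀t hPi₀
  have hjt : j ≤ t := Nat.findGreatest_le t
  have hne : j ≠ t := fun e => by rw [e] at hPj; exact (not_le.2 ht) hPj.2
  refine ⟨j, hPj.1, lt_of_le_of_ne hjt hne, hPj.2, fun i hji hit => ?_⟩
  have := Nat.findGreatest_is_greatest hji hit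
  by_contra hcon
  exact this ⟨hPj.1.trans hji.le, not_lt.1 hcon⟩

/-- **First index `≥ ℓ`**: if `h s < ℓ ≤ h t` (`s ≤ t`), there is a first `j ∈ (s, t]` with `h j ≥ ℓ`; before it
(from `s`) the sequence is `< ℓ`. [folklore] -/
theorem exists_first_ge {h : ℕ → ℝ} {ℓ : ℝ} {s t : ℕ} (hst : s ≤ t) (hs : h s < ℓ) (ht : ℓ ≤ h t) :
    ∃ j, s < j ∧ j ≤ t ∧ ℓ ≤ h j ∧ ∀ i, s ≤ i → i < j → h i < ℓ := by
  set P : ℕ → Prop := fun i => s ≤ i ∧ ℓ ≤ h i with hP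
  have hex : ∃ i, P i := ⟨t, hst, ht⟩
  set j := Nat.find hex with hj
  have hPj : P j := Nat.find_spec hex
  have hjt : j ≤ t := Nat.find_min' hex ⟨hst, ht⟩
  have hne : j ≠ s := fun e => by rw [e] at hPj; exact (not_le.2 hs) hPj.2
  refine ⟨j, lt_of_le_of_ne hPj.1 (Ne.symm hne), hjt, hPj.2, fun i hsi hij => ?_⟩
  have := Nat.find_min hex hij
  by_contra hcon
  exact this ⟨hsi, not_lt.1 hcon⟩

/-- **Last index `≤ ℓ`** (mirror image of `exists_last_ge`). [folklore] -/
theorem exists_last_le {h : ℕ → ℝ} {ℓ : ℝ} {s t : ℕ} (hst : s ≤ t) (hs : h s ≤ ℓ) (ht : ℓ < h t) :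
    ∃ j, s ≤ j ∧ j < t ∧ h j ≤ ℓ ∧ ∀ i, j < i → i ≤ t → ℓ < h i := by
  obtain ⟨j, h1, h2, h3, h4⟩ := exists_last_ge (h := fun i => -h i) (ℓ := -ℓ) hst (neg_le_neg hs) (neg_lt_neg ht)
  exact ⟨j, h1, h2, neg_le_neg_iff.1 h3, fun i hi hi' => neg_lt_neg_iff.1 (h4 i hi hi')⟩

/-- **First index `≤ ℓ`** (mirror image of `exists_first_ge`). [folklore] -/
theorem exists_first_le {h : ℕ → ℝ} {ℓ : ℝ} {s t : ℕ} (hst : s ≤ t) (hs : ℓ < h s) (ht : h t ≤ ℓ) :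
    ∃ j, s < j ∧ j ≤ t ∧ h j ≤ ℓ ∧ ∀ i, s ≤ i → i < j → ℓ < h i := by
  obtain ⟨j, h1, h2, h3, h4⟩ := exists_first_ge (h := fun i => -h i) (ℓ := -ℓ) hst (neg_lt_neg hs) (neg_le_neg ht)
  exact ⟨j, h1, h2, neg_le_neg_iff.1 h3, fun i hi hi' => neg_lt_neg_iff.1 (h4 i hi hi')⟩

namespace WSetting

variable (X : WSetting)

/-! ### Heights -/

/-- **The height** of a position: the chart radius of its site. [folklore] -/
def hgt (i : ℕ) : ℝ := X.rad (X.site i)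

/-- `hgt` unfolded. [folklore] -/
theorem hgt_def (i : ℕ) : X.hgt i = X.rad (X.site i) := rfl

/-- Heights lie in `[w₁, w₂]`. [folklore] -/
theorem hgt_mem (i : ℕ) : X.w₁ ≤ X.hgt i ∧ X.hgt i ≤ X.w₂ := X.site_rad i

/-- Heights are `N`-periodic. [folklore] -/
theorem hgt_add_N (i : ℕ) : X.hgt (i + X.N) = X.hgt i := by rw [hgt_def, hgt_def, site_def, site_def, dart_add_N]

/-- **Heights move by at most `κ` per step.** [folklore] -/
theorem abs_hgt_sub_le (i : ℕ) : |X.hgt (i + 1) - X.hgt i| ≤ X.κ := by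
  rw [hgt_def, hgt_def, rad_def, rad_def]
  refine (abs_norm_sub_norm_le _ _).trans ?_
  rw [← dist_eq_norm]; exact X.chart_step i

/-- Heights move by at most `n κ` over `n` steps. [folklore] -/
theorem abs_hgt_sub_le' (i n : ℕ) : |X.hgt (i + n) - X.hgt i| ≤ n * X.κ := by
  induction n with
  | zero => simp
  | succ n ih =>
    have h := X.abs_hgt_sub_le (i + n)
    rw [abs_le] at h ih ⊢
    rw [show i + (n + 1) = i + n + 1 by ring]
    push_cast
    constructor
    · linarith [h.1, ih.1]
    · linarith [h.2, ih.2]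

/-- An inner position is low: height `< w₁ + κ`. [folklore] -/
theorem hgt_lt_of_inner {i : ℕ} (hi : i ∈ X.inner) : X.hgt i < X.w₁ + X.κ := X.rad_lt_of_inner hi

/-- An outer position is high: height `> w₂ - κ`. [folklore] -/
theorem lt_hgt_of_outer {i : ℕ} (hi : i ∈ X.outer) : X.w₂ - X.κ < X.hgt i := X.lt_rad_of_outer hi

/-- **A position of mid height is rough.** [folklore] -/
theorem not_rim_of_mid {i : ℕ} (h1 : X.w₁ + X.κ ≤ X.hgt i) (h2 : X.hgt i ≤ X.w₂ - X.κ) : i ∉ X.rim := by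
  intro hi
  rcases X.rim_cases hi with h | h
  · linarith [X.hgt_lt_of_inner h]
  · linarith [X.lt_hgt_of_outer h]

/-- The parameter of a left position is within `κ` of minus its height. [folklore] -/
theorem u_of_lft {i : ℕ} (hi : i ∈ X.lft) : -X.hgt i - X.κ ≤ X.u i ∧ X.u i ≤ -X.hgt i + X.κ := by
  have h := abs_le.1 (X.u_facts hi.1).1
  rw [abs_of_neg hi.2, ← hgt_def] at h
  constructor <;> linarith [h.1, h.2]

/-- The parameter of a right position is within `κ` of its height. [folklore] -/
theorem u_of_rgt {i : ℕ} (hi : i ∈ X.rgt) : X.hgt i - X.κ ≤ X.u i ∧ X.u i ≤ X.hgt i + X.κ := by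
  have h := abs_le.1 (X.u_facts hi.1).1
  rw [abs_of_pos hi.2, ← hgt_def] at h
  constructor <;> linarith [h.1, h.2]

/-! ### Hands along rough intervals -/

/-- **Consecutive rough positions have parameters within `3κ`.** [folklore] -/
theorem abs_u_sub_u_le {i : ℕ} (hi : i ∉ X.rim) (hi' : i + 1 ∉ X.rim) : |X.u (i + 1) - X.u i| ≤ 3 * X.κ := by
  have h1 := (X.u_facts hi).2.2
  have h2 := (X.u_facts hi').2.2
  have h3 := X.chart_step i
  rw [Complex.dist_eq] at h3
  have h4 := (abs_re_le_norm _).trans h3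
  rw [Complex.sub_re] at h4
  rw [abs_le] at h1 h2 h4 ⊢
  constructor <;> linarith [h1.1, h1.2, h2.1, h2.2, h4.1, h4.2]

/-- Consecutive rough positions have the same hand. [folklore] -/
theorem lft_succ_iff {i : ℕ} (hi : i ∉ X.rim) (hi' : i + 1 ∉ X.rim) : i + 1 ∈ X.lft ↔ i ∈ X.lft := by
  have h := abs_le.1 (X.abs_u_sub_u_le hi hi')
  have hw : 10 * X.κ < X.w₁ := by obtain ⟨hm, hκ, hκm, hr₁, hw₁, -⟩ := X.radii'; linarith
  constructor
  · intro h1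
    rcases X.lft_or_rgt hi with h2 | h2
    · exact h2
    · linarith [X.u_le_of_lft h1, X.le_u_of_rgt h2, h.1]
  · intro h1
    rcases X.lft_or_rgt hi' with h2 | h2
    · exact h2
    · linarith [X.u_le_of_lft h1, X.le_u_of_rgt h2, h.2]

/-- **The hand is constant along an interval of rough positions.** [folklore] -/
theorem lft_iff_of_interval {s t : ℕ} (hrough : ∀ i, s ≤ i → i ≤ t → i ∉ X.rim) {i j : ℕ}
    (hsi : s ≤ i) (hit : i ≤ t) (hsj : s ≤ j) (hjt : j ≤ t) : i ∈ X.lft ↔ j ∈ X.lft := by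
  -- both are equivalent to `s ∈ lft`
  suffices key : ∀ n, s + n ≤ t → (s + n ∈ X.lft ↔ s ∈ X.lft) by
    obtain ⟨a, rfl⟩ := Nat.exists_eq_add_of_le hsi
    obtain ⟨b, rfl⟩ := Nat.exists_eq_add_of_le hsj
    rw [key a hit, key b hjt]
  intro n
  induction n with
  | zero => intro; simp
  | succ n ih =>
    intro hn
    have e : s + (n + 1) = (s + n) + 1 := by ring
    rw [e] at hn ⊢
    rw [X.lft_succ_iff (hrough (s + n) (by omega) (by omega)) (hrough (s + n + 1) (by omega) hn)]
    exact ih (by omega)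

/-- Along an interval of rough positions off `lft`, every position is right. [folklore] -/
theorem rgt_of_interval {s t : ℕ} (hrough : ∀ i, s ≤ i → i ≤ t → i ∉ X.rim) {i j : ℕ}
    (hsi : s ≤ i) (hit : i ≤ t) (hsj : s ≤ j) (hjt : j ≤ t) (hi : i ∈ X.rgt) : j ∈ X.rgt := by
  rcases X.lft_or_rgt (hrough j hsj hjt) with h | h
  · have := (X.lft_iff_of_interval hrough hsi hit hsj hjt).2 h
    exact absurd hi.2 (not_lt.2 this.2.le)
  · exact h

/-! ### Mid intervals -/

/-- **An interval without low or high positions strictly inside two given positions is mid**, in the form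
used below: if no position of `[s, t]` is low (`< w₁ + κ`) or high (`> w₂ - κ`), all its positions are rough
and of one hand. [folklore] -/
theorem rough_of_mid_interval {s t : ℕ} (hmid : ∀ i, s ≤ i → i ≤ t → X.w₁ + X.κ ≤ X.hgt i ∧ X.hgt i ≤ X.w₂ - X.κ) :
    ∀ i, s ≤ i → i ≤ t → i ∉ X.rim :=
  fun i hsi hit => X.not_rim_of_mid (hmid i hsi hit).1 (hmid i hsi hit).2

end WSetting

end WindowRect

/-- **Heights of the boundary cycle move by at most `κ` per step**, closed form (registered sub-goal of
stmt-CriticalPhenomena-10650). [folklore] -/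
theorem windowRect_abs_hgt_sub_le : ∀ (X : WindowRect.WSetting) (i : ℕ), |X.hgt (i + 1) - X.hgt i| ≤ X.κ :=
  fun X i => X.abs_hgt_sub_le i

end Summit.CriticalPhenomena.SAWScalingLimit.Theorems.IsingBoundaryRatio

end
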